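import Summits.ResolutionOfSingularities.ResolutionOfSingularities.Theorems.MarkedTransferCampaignW46LargeCharRegime
import Summits.ResolutionOfSingularities.ResolutionOfSingularities.Theorems.MarkedTransferCampaignW46LargeCharStatement
import Summits.ResolutionOfSingularities.ResolutionOfSingularities.Theorems.MarkedTransferCampaignW46LiteralCentreProcrastination
import Literature.AlgebraicGeometry.Resolution.BlowupsProperProofs
import HarnessLib

/-!
# [OURS · L1 W4.6, rung (iv) «large characteristic», non-vacuity] Every step of the typed Th. 16.6 procedure has a
# closed point over its centre; hence from a résumé terminal at stage 0 the ∇-centred step NEVER satisfies the typed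
# Eq. (127) — companion of `Theorems/MarkedTransferCampaignW46LargeCharRegime.lean`
# (cell res-hironaka, LADDER-RESOLUTION rung L, D-0089; slot W4.6, seat res-L1-s46-pv-7; host route MarkedTransfer,
# `--supports stmt-ResolutionOfSingularities-16155 --as helper`)

HONEST FRAMING. Nothing here is a statement of H. Hironaka's manuscript (2017-03-23, [Hironaka2017]) and nothing here
asserts that any statement of it holds. Scheme-theoretic lemmas (tree `Resolution.IsBlowup`, Mathlib) and pure logic
over the OURS definitions `CampaignW46.Step`, `Step.Decrease`, `DecreaseAlongSteps` (res-L1-type-o1) and the typed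
CANDIDATE carriers (row 019 `S16Proof.MTIDatum`), used as DEFINITIONS and HYPOTHESES only. AI review is weaker than
expert review. No `sorry`; axioms standard.

## Content

* `exists_mem_preimage_of_isBlowup` — a blow-up `π : Z′ → Z` of an IRREDUCIBLE locally Noetherian scheme along the
  reduced ideal of a non-empty closed `D`, with `Z′` non-empty, has a point over `D`: `π` is proper (tree
  `IsBlowup.isProper`) hence closed, an isomorphism over `Z ∖ D` (tree `IsBlowup.isIso_compl`), so if nothing lay over
  `D` the image `Z ∖ D` would be clopen, i.e. empty or everything, contradicting `Z′ ≠ ∅` resp. `D ≠ ∅`.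
* `exists_closedPoint_over_of_isBlowup` — with `Z′` Jacobson the point may be taken closed.
* `Step.exists_closedPoint_over` — for a step of the typed procedure (row 001 `AmbientDatum`: `Z`, `Z′` smooth
  irreducible quasi-compact over the field `K`, hence locally Noetherian and Jacobson — `ambient_isLocallyNoetherian`,
  `ambient_jacobsonSpace` of `MarkedTransferCampaignW46LiteralCentreProcrastination`) there is a closed point `ξ′` of
  `Z′` with `π ξ′ ∈ D`.
* `Step.not_decrease_of_m_eq_zero_of_nabla_subset` / `StepNabla.not_decrease_of_m_eq_zero` — from a résumé terminal
  at stage `0` (`m = 0`, design point (M); = «every member of `𝔜(0)` has `℘` generated in degree one», the classical /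
  large-`p` résumé, `Resume.m_eq_zero_iff_genDegOne_zero`) the ∇-centred step (centre `⊇ ∇(E)`, e.g. a `StepNabla` with
  irreducible `∇(E)`) satisfies the typed Eq. (127)-for-the-step for NO résumé of the transform.
* `tameWitnessNabla_of_resumes`, `tameWitness_of_resumes`, `tameWitness_of_stepNabla` — the witness SHAPES of
  `MarkedTransferCampaignW46LargeCharStatement` (res-L1-type-o1, p473772) from résumé data alone.
* `not_decreaseAlongSteps_of_tame_nabla`, `not_decreaseAlongSteps_charGT_of_tame_nabla` — hence such a state in a
  regime refutes `DecreaseAlongSteps` there (any `N`, `Rd`; in particular `Regime.charGT n C` for every explicit `C`),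
  given only a résumé of the transform read by `Rd` (résumé EXISTENCE is the typed rows' posit, row 091 `U78L2`; this
  file constructs none). READING under design point (M), not a verdict (see the companion's module docstring).

* Appended 2026-08-27: `compl_subset_range_of_isBlowup`, `surjective_of_isBlowup`, `exists_closedPoint_over_mem_of_isBlowup`,
  `Step.surjective`, `Step.exists_closedPoint_over_mem` — a step with centre `≠ Z` is onto, so EVERY closed point of
  the centre has a closed point of `Z′` over it.

References: companion module `MarkedTransferCampaignW46LargeCharRegime` (p471737); H. Hironaka, ms. 2017-03-23, Th. 16.6
(2)/(4) p.84 l.10–20, l.29 — scope only, under adjudication, not cited as fact [Hironaka2017]; Görtz–Wedhorn I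
Prop. 13.91 / Stacks 02OS through the tree's `IsBlowup` API.
-/

noncomputable section

set_option linter.dupNamespace false -- mandated namespace of this single-conjunct summit

open CategoryTheory AlgebraicGeometry TopologicalSpace

namespace Summit.ResolutionOfSingularities.ResolutionOfSingularities.Theorems
namespace CampaignW46

open Literature.AlgebraicGeometry.Resolution
open Literature.AlgebraicGeometry.Hironaka2017 (S02Preliminaries.closedPoints)
open Literature.AlgebraicGeometry.Hironaka2017.S02Preliminaries hiding closedPoints
open Literature.AlgebraicGeometry.Hironaka2017.Datum
open Literature.AlgebraicGeometry.Hironaka2017.S15ARSchemes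
open Literature.AlgebraicGeometry.Hironaka2017.S16Proof

universe u

/-! ## Blow-ups along non-empty centres have points over the centre -/

section Blowup

/-- **A blow-up of an irreducible scheme along a non-empty closed centre has a point over the centre.** For
`π : Z′ → Z` a blow-up (tree `IsBlowup`) of the irreducible locally Noetherian `Z` along the reduced ideal sheaf of the
non-empty closed `D`, with `Z′` non-empty: some point of `Z′` maps into `D`. (`π` is proper, hence a closed map, and an
isomorphism over `Z ∖ D`; were nothing over `D`, the image `Z ∖ D` would be clopen in the irreducible `Z`.) [folklore] -/
theorem exists_mem_preimage_of_isBlowup {Z Z' : Scheme.{u}} [IrreducibleSpace Z] [IsLocallyNoetherian Z]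
    [Nonempty Z'] {π : Z' ⟶ Z} {D : Closeds Z} (hπ : IsBlowup π (Scheme.IdealSheafData.vanishingIdeal D))
    (hD : (D : Set Z).Nonempty) : ∃ ξ' : Z', π ξ' ∈ (D : Set Z) := by
  by_contra h
  push Not at h
  haveI : IsProper π := hπ.isProper
  -- the open complement of the centre
  set U : Set Z := (D : Set Z)ᶜ with hU
  have hUo : IsOpen U := D.isClosed.isOpen_compl
  -- the image of `π` is `U`
  have hrange : Set.range (fun x : Z' => π x) = U := by
    apply Set.Subset.antisymm
    · rintro _ ⟨x, rfl⟩
      exact h x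
    · intro z hz
      have hsupp : ((Scheme.IdealSheafData.vanishingIdeal D).support : Set Z) = (D : Set Z) :=
        Scheme.IdealSheafData.coe_support_vanishingIdeal D
      haveI := hπ.isIso_compl
      let V : Z.Opens := ⟨((Scheme.IdealSheafData.vanishingIdeal D).support : Set Z)ᶜ,
        (Scheme.IdealSheafData.vanishingIdeal D).support.isClosed.isOpen_compl⟩
      have hzV : z ∈ V := by
        change z ∈ ((Scheme.IdealSheafData.vanishingIdeal D).support : Set Z)ᶜ
        rw [hsupp]
        exact hz
      obtain ⟨y, hy⟩ := (π ∣_ V).surjective ⟨z, hzV⟩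
      refine ⟨y.1, ?_⟩
      have := congrArg Subtype.val hy
      simpa [morphismRestrict_base_coe] using this
  -- hence `U` is closed (proper maps are closed) and open
  have hUc : IsClosed U := by
    rw [← hrange]
    exact π.isClosedMap.isClosed_range
  -- in an irreducible space a non-empty open set is dense, so `U = Z` or `U = ∅`
  rcases Set.eq_empty_or_nonempty U with hUe | hUne
  · -- `U = ∅`: then `D = Z` and every point of the non-empty `Z′` lies over `D`
    obtain ⟨x⟩ := (inferInstance : Nonempty Z')
    apply h x
    have : π x ∉ U := by rw [hUe]; exact Set.notMem_empty _
    simpa [hU] using this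
  · have hdense : Dense U := hUo.dense hUne
    have hUuniv : U = Set.univ := by rw [← hUc.closure_eq, hdense.closure_eq]
    obtain ⟨d, hd⟩ := hD
    have : d ∈ U := by rw [hUuniv]; exact Set.mem_univ d
    exact this hd

/-- The same with a CLOSED point of `Z′` over the centre, when `Z′` is a Jacobson space (e.g. locally of finite type
over a field). [folklore] -/
theorem exists_closedPoint_over_of_isBlowup {Z Z' : Scheme.{u}} [IrreducibleSpace Z] [IsLocallyNoetherian Z]
    [Nonempty Z'] [JacobsonSpace Z'] {π : Z' ⟶ Z} {D : Closeds Z}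
    (hπ : IsBlowup π (Scheme.IdealSheafData.vanishingIdeal D)) (hD : (D : Set Z).Nonempty) :
    ∃ ξ' : Z', IsClosed ({ξ'} : Set Z') ∧ π ξ' ∈ (D : Set Z) := by
  obtain ⟨ξ, hξ⟩ := exists_mem_preimage_of_isBlowup hπ hD
  have hcl : IsClosed ((fun x : Z' => π x) ⁻¹' (D : Set Z)) := D.isClosed.preimage π.continuous
  obtain ⟨ξ', hξ'D, hξ'cl⟩ :=
    nonempty_inter_closedPoints (Z := (fun x : Z' => π x) ⁻¹' (D : Set Z)) ⟨ξ, hξ⟩ hcl.isLocallyClosed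
  exact ⟨ξ', hξ'cl, hξ'D⟩

end Blowup

variable {n : ℕ} {p : ℕ} [Fact p.Prime] {K : Type u} [Field K] [CharP K p]

/-! ## Every step of the typed procedure has a closed point over its centre -/

section StepPoints

variable {N : Notions.{u} n} {A A' : AmbientDatum p K} {E : IdealExponent A.Z}

/-- [OURS · L1 W4.6 (iv) non-vacuity; NOT a statement of the manuscript] **Every step of the typed procedure has a
closed point over its centre**: for a step `s` (blow-up `π : Z′ → Z` of the irreducible smooth `Z` along the admitted
centre `D ≠ ∅`, onto the irreducible smooth `Z′` over the same `K`) there is a closed point `ξ′` of `Z′` with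
`π ξ′ ∈ D`. [folklore] -/
theorem Step.exists_closedPoint_over {R : Resume N A E} (s : Step R A') :
    ∃ ξ' : A'.Z, ξ' ∈ S02Preliminaries.closedPoints A'.Z ∧ s.π ξ' ∈ (s.D : Set A.Z) := by
  haveI : IrreducibleSpace A.Z := A.irreducible
  haveI : IsLocallyNoetherian A.Z := ambient_isLocallyNoetherian A
  haveI : IrreducibleSpace A'.Z := A'.irreducible
  haveI : JacobsonSpace A'.Z := ambient_jacobsonSpace A'
  obtain ⟨ξ', hcl, hD⟩ := exists_closedPoint_over_of_isBlowup s.blowup s.centre.irreducible.nonempty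
  exact ⟨ξ', hcl, hD⟩

end StepPoints

/-! ## The ∇-centred step from a tame résumé never satisfies the typed Eq. (127) -/

section TameNabla

variable {N : Notions.{u} n} {A A' : AmbientDatum p K} {E : IdealExponent A.Z}

/-- [OURS · L1 W4.6 (iv); NOT a statement of the manuscript] **From a résumé terminal at stage `0`, the ∇-centred step
satisfies Eq. (127) for NO résumé of the transform** (design point (M) `m := t`): with `∇(E) ⊆ D` the locus condition
`ξ′ ∉ D′` is void (`D′ = ∅`) and a closed point over the centre always exists (`Step.exists_closedPoint_over`), where
the displayed inequality against the EMPTY unprimed string fails. [folklore] -/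
theorem Step.not_decrease_of_m_eq_zero_of_nabla_subset {R : Resume N A E} (s : Step R A')
    (R' : Resume N A' s.E') (hm : R.m = 0) (hD : (R.nabla : Set A.Z) ⊆ (s.D : Set A.Z)) :
    ¬ s.Decrease R' := by
  rw [s.decrease_iff_of_m_eq_zero_of_nabla_subset R' hm hD]
  obtain ⟨ξ', hcl, hDξ⟩ := s.exists_closedPoint_over
  exact fun h => h ξ' hcl hDξ

/-- [OURS · L1 W4.6 (iv); NOT a statement of the manuscript] The same for a ∇-step (`StepNabla`: centre = a component
of `∇(E)`) when `∇(E)` is irreducible. [folklore] -/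
theorem StepNabla.not_decrease_of_m_eq_zero {R : Resume N A E} (s : StepNabla R A')
    (R' : Resume N A' s.toStep.E') (hm : R.m = 0) (hirr : IsIrreducible (R.nabla : Set A.Z)) :
    ¬ s.toStep.Decrease R' :=
  s.toStep.not_decrease_of_m_eq_zero_of_nabla_subset R' hm (s.component.nabla_subset_of_isIrreducible hirr)

end TameNabla

/-! ## Hence: a tame ∇-centred state with a résumé of its transform refutes the one-step rung shape -/

section Witness

variable {N : Notions.{u} n} {Rd : Reading p K N}

/-- [OURS · L1 W4.6 (iv); NOT a statement of the manuscript] **A tame ∇-centred state refutes `DecreaseAlongSteps`**: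
a state `(A, E)` in the regime with a résumé `R` read by `Rd` and terminal at stage `0`, a step whose centre contains
`∇(E)`, and ANY résumé of the transform read by `Rd` contradict `DecreaseAlongSteps N Rd Rg` — no point datum needed
(compare the companion's `not_decreaseAlongSteps_of_tameWitness_nabla`). [folklore] -/
theorem not_decreaseAlongSteps_of_tame_nabla {Rg : Regime p K} {A : AmbientDatum p K} {E : IdealExponent A.Z}
    (R : Resume N A E) (hRg : Rg A E) (hRd : Rd A E R) (hm : R.m = 0) {A' : AmbientDatum p K} (s : Step R A')
    (hDn : (R.nabla : Set A.Z) ⊆ (s.D : Set A.Z)) (R' : Resume N A' s.E') (hRd' : Rd A' s.E' R') :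
    ¬ DecreaseAlongSteps N Rd Rg :=
  fun h => s.not_decrease_of_m_eq_zero_of_nabla_subset R' hm hDn (h A E R hRg hRd A' s R' hRd').1

/-- [OURS · L1 W4.6 (iv); NOT a statement of the manuscript] The specialisation to the large-characteristic regime
`Regime.charGT n C`, for every explicit threshold `C`. [folklore] -/
theorem not_decreaseAlongSteps_charGT_of_tame_nabla (C : ℕ → ℕ → ℕ) {A : AmbientDatum p K}
    {E : IdealExponent A.Z} (hC : C n E.b < p) (R : Resume N A E) (hRd : Rd A E R) (hm : R.m = 0)
    {A' : AmbientDatum p K} (s : Step R A') (hDn : (R.nabla : Set A.Z) ⊆ (s.D : Set A.Z))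
    (R' : Resume N A' s.E') (hRd' : Rd A' s.E' R') : ¬ DecreaseAlongSteps N Rd (Regime.charGT n C) :=
  not_decreaseAlongSteps_of_tame_nabla (Rg := Regime.charGT n C) R hC hRd hm s hDn R' hRd'

/-- [OURS · L1 W4.6 (iv); NOT a statement of the manuscript] ∇-step form with irreducible `∇(E)`. [folklore] -/
theorem not_decreaseAlongSteps_of_tame_stepNabla {Rg : Regime p K} {A : AmbientDatum p K}
    {E : IdealExponent A.Z} (R : Resume N A E) (hRg : Rg A E) (hRd : Rd A E R) (hm : R.m = 0)
    (hirr : IsIrreducible (R.nabla : Set A.Z)) {A' : AmbientDatum p K} (s : StepNabla R A')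
    (R' : Resume N A' s.toStep.E') (hRd' : Rd A' s.toStep.E' R') : ¬ DecreaseAlongSteps N Rd Rg :=
  not_decreaseAlongSteps_of_tame_nabla R hRg hRd hm s.toStep (s.component.nabla_subset_of_isIrreducible hirr) R' hRd'

end Witness

/-! ## The witness shapes of `MarkedTransferCampaignW46LargeCharStatement` from résumé data alone -/

section Shapes

variable {N : Notions.{u} n} {Rd : Reading p K N}

/-- [OURS · L1 W4.6 (iv) non-vacuity; NOT a statement of the manuscript] **`TameWitnessNabla` from résumé data
alone**: a state in the regime with a résumé terminal at stage `0` read by `Rd`, a step whose centre contains `∇(E)`,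
and a résumé of the transform read by `Rd` — the closed point over the centre is supplied by
`Step.exists_closedPoint_over`. (Résumé EXISTENCE remains the typed rows' posit; nothing is constructed.) [folklore] -/
theorem tameWitnessNabla_of_resumes {Rg : Regime p K} {A : AmbientDatum p K} {E : IdealExponent A.Z}
    (R : Resume N A E) (hRg : Rg A E) (hRd : Rd A E R) (hm : R.m = 0) {A' : AmbientDatum p K} (s : Step R A')
    (hDn : (R.nabla : Set A.Z) ⊆ (s.D : Set A.Z)) (R' : Resume N A' s.E') (hRd' : Rd A' s.E' R') :
    TameWitnessNabla N Rd Rg := by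
  obtain ⟨ξ', hcl, hD⟩ := s.exists_closedPoint_over
  exact ⟨A, E, R, hRg, hRd, hm, A', s, hDn, R', hRd', ξ', hcl, hD⟩

/-- [OURS · L1 W4.6 (iv) non-vacuity; NOT a statement of the manuscript] **`TameWitness` from résumé data alone** in
the ∇-centred case: as above, the off-`D′` condition being void (`D′ = ∅`). [folklore] -/
theorem tameWitness_of_resumes {Rg : Regime p K} {A : AmbientDatum p K} {E : IdealExponent A.Z}
    (R : Resume N A E) (hRg : Rg A E) (hRd : Rd A E R) (hm : R.m = 0) {A' : AmbientDatum p K} (s : Step R A')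
    (hDn : (R.nabla : Set A.Z) ⊆ (s.D : Set A.Z)) (R' : Resume N A' s.E') (hRd' : Rd A' s.E' R') :
    TameWitness N Rd Rg := by
  obtain ⟨ξ', hcl, hD⟩ := s.exists_closedPoint_over
  refine ⟨A, E, R, hRg, hRd, hm, A', s, R', hRd', ξ', hcl, hD, ?_⟩
  rw [mtiDatum_dPrime_eq_empty R.mti s.π s.D hDn]
  exact Set.notMem_empty _

/-- [OURS · L1 W4.6 (iv) non-vacuity; NOT a statement of the manuscript] ∇-step form (irreducible `∇(E)`): a
`StepNabla` from a tame résumé with a résumé of its transform is a tame witness. [folklore] -/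
theorem tameWitness_of_stepNabla {Rg : Regime p K} {A : AmbientDatum p K} {E : IdealExponent A.Z}
    (R : Resume N A E) (hRg : Rg A E) (hRd : Rd A E R) (hm : R.m = 0) (hirr : IsIrreducible (R.nabla : Set A.Z))
    {A' : AmbientDatum p K} (s : StepNabla R A') (R' : Resume N A' s.toStep.E') (hRd' : Rd A' s.toStep.E' R') :
    TameWitness N Rd Rg :=
  tameWitness_of_resumes R hRg hRd hm s.toStep (s.component.nabla_subset_of_isIrreducible hirr) R' hRd'

end Shapes

/-! ## Appended 2026-08-27 (res-L1-s46-pv-7): blow-ups of irreducible schemes along non-dense centres are SURJECTIVE,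
## so every closed point of the centre has a closed point of `Z′` over it -/

section Surjective

/-- The image of a blow-up along the reduced ideal of a closed `D` contains `Z ∖ D` (tree `IsBlowup.isIso_compl`: the
blow-up is an isomorphism over the complement of its centre). [folklore] -/
theorem compl_subset_range_of_isBlowup {Z Z' : Scheme.{u}} {π : Z' ⟶ Z} {D : Closeds Z}
    (hπ : IsBlowup π (Scheme.IdealSheafData.vanishingIdeal D)) :
    (D : Set Z)ᶜ ⊆ Set.range (fun x : Z' => π x) := by
  intro z hz
  have hsupp : ((Scheme.IdealSheafData.vanishingIdeal D).support : Set Z) = (D : Set Z) :=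
    Scheme.IdealSheafData.coe_support_vanishingIdeal D
  haveI := hπ.isIso_compl
  let V : Z.Opens := ⟨((Scheme.IdealSheafData.vanishingIdeal D).support : Set Z)ᶜ,
    (Scheme.IdealSheafData.vanishingIdeal D).support.isClosed.isOpen_compl⟩
  have hzV : z ∈ V := by
    change z ∈ ((Scheme.IdealSheafData.vanishingIdeal D).support : Set Z)ᶜ
    rw [hsupp]
    exact hz
  obtain ⟨y, hy⟩ := (π ∣_ V).surjective ⟨z, hzV⟩
  refine ⟨y.1, ?_⟩
  have := congrArg Subtype.val hy
  simpa [morphismRestrict_base_coe] using this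

/-- **A blow-up of an irreducible locally Noetherian scheme along a non-dense closed centre is surjective**: the image
is closed (`π` proper) and contains the dense open `Z ∖ D`. [folklore] -/
theorem surjective_of_isBlowup {Z Z' : Scheme.{u}} [IrreducibleSpace Z] [IsLocallyNoetherian Z] {π : Z' ⟶ Z}
    {D : Closeds Z} (hπ : IsBlowup π (Scheme.IdealSheafData.vanishingIdeal D)) (hD : (D : Set Z) ≠ Set.univ) :
    Function.Surjective (fun x : Z' => π x) := by
  haveI : IsProper π := hπ.isProper
  have hclosed : IsClosed (Set.range (fun x : Z' => π x)) := π.isClosedMap.isClosed_range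
  have hdense : Dense ((D : Set Z)ᶜ) := D.isClosed.isOpen_compl.dense (Set.nonempty_compl.mpr hD)
  have hrange : Set.range (fun x : Z' => π x) = Set.univ := by
    rw [← hclosed.closure_eq, (hdense.mono (compl_subset_range_of_isBlowup hπ)).closure_eq]
  exact Set.range_eq_univ.mp hrange

/-- With `Z′` Jacobson: every CLOSED point of a non-dense centre has a CLOSED point of `Z′` over it. [folklore] -/
theorem exists_closedPoint_over_mem_of_isBlowup {Z Z' : Scheme.{u}} [IrreducibleSpace Z] [IsLocallyNoetherian Z]
    [JacobsonSpace Z'] {π : Z' ⟶ Z} {D : Closeds Z} (hπ : IsBlowup π (Scheme.IdealSheafData.vanishingIdeal D))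
    (hD : (D : Set Z) ≠ Set.univ) {ξ : Z} (hξ : IsClosed ({ξ} : Set Z)) :
    ∃ ξ' : Z', IsClosed ({ξ'} : Set Z') ∧ π ξ' = ξ := by
  obtain ⟨x, hx⟩ := surjective_of_isBlowup hπ hD ξ
  have hcl : IsClosed ((fun y : Z' => π y) ⁻¹' ({ξ} : Set Z)) := hξ.preimage π.continuous
  obtain ⟨ξ', hξ'F, hξ'cl⟩ :=
    nonempty_inter_closedPoints (Z := (fun y : Z' => π y) ⁻¹' ({ξ} : Set Z)) ⟨x, hx⟩ hcl.isLocallyClosed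
  exact ⟨ξ', hξ'cl, hξ'F⟩

variable {N : Notions.{u} n} {A A' : AmbientDatum p K} {E : IdealExponent A.Z}

/-- [OURS · L1 W4.6 (iv) non-vacuity; NOT a statement of the manuscript] **A step of the typed procedure whose centre is
not all of `Z` is surjective** (`Z′ → Z` onto). [folklore] -/
theorem Step.surjective {R : Resume N A E} (s : Step R A') (hD : (s.D : Set A.Z) ≠ Set.univ) :
    Function.Surjective (fun x : A'.Z => s.π x) := by
  haveI : IrreducibleSpace A.Z := A.irreducible
  haveI : IsLocallyNoetherian A.Z := ambient_isLocallyNoetherian A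
  exact surjective_of_isBlowup s.blowup hD

/-- [OURS · L1 W4.6 (iv) non-vacuity; NOT a statement of the manuscript] **Every closed point of the centre of a step has
a closed point of `Z′` over it** (centre not all of `Z`): the locus of Eq. (127) «closed `ξ′` with `π ξ′ ∈ D`» is
non-empty over EVERY closed point of `D`, not only somewhere. [folklore] -/
theorem Step.exists_closedPoint_over_mem {R : Resume N A E} (s : Step R A') (hD : (s.D : Set A.Z) ≠ Set.univ)
    {ξ : A.Z} (hξ : ξ ∈ S02Preliminaries.closedPoints A.Z) :
    ∃ ξ' : A'.Z, ξ' ∈ S02Preliminaries.closedPoints A'.Z ∧ s.π ξ' = ξ := by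
  haveI : IrreducibleSpace A.Z := A.irreducible
  haveI : IsLocallyNoetherian A.Z := ambient_isLocallyNoetherian A
  haveI : JacobsonSpace A'.Z := ambient_jacobsonSpace A'
  obtain ⟨ξ', hcl, hπ⟩ := exists_closedPoint_over_mem_of_isBlowup s.blowup hD hξ
  exact ⟨ξ', hcl, hπ⟩

end Surjective

end CampaignW46
end Summit.ResolutionOfSingularities.ResolutionOfSingularities.Theorems

end
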